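import Summits.Ventures.DiscreteObjects.UnitDistance.ReductionTowerZMod121Data
import HarnessLib

/-!
# `G₂(11)` is not 4-colourable — kernel search, piece 1 of 3 (sub-searches below `z121Q1, z121Q2, z121Q3`)

Framing (verbatim for the cell): lottery ticket; floor = certified bounds/negative ranges.

Each state `z121Qi` of `ReductionTowerZMod121Data.lean` is refuted by the bit-vector colouring search of `KernelColouringSearch.lean`
(`decide +kernel`, one evaluation per state: 382, 411, 311 branch nodes), and `z121_pieceI` packages the logical
statement used by `ReductionTowerZMod121.lean`: no proper 4-colouring is consistent with `z121Qi`.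
-/

namespace Summit.Ventures.DiscreteObjects.UnitDistance

open KBits

set_option maxHeartbeats 400000000 in
set_option maxRecDepth 200000 in
/-- KERNEL FACT: the search refutes every 4-colouring below `z121Q1`. -/
theorem z121Q1_run : search z121nb 494 200 [] 494 z121Q1 = true := by
  decide +kernel

/-- PIECE: no proper 4-colouring (for the neighbourhood words `z121nb`) is consistent with the state `z121Q1`. -/
theorem z121_piece1 {col : ℕ → ℕ} (hP : Proper z121nb 494 col) :
    UBound 494 z121Q1 → Cons 494 col z121Q1 → False :=
  search_sound hP (done := []) (by simp) 494 _ z121Q1_run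

set_option maxHeartbeats 400000000 in
set_option maxRecDepth 200000 in
/-- KERNEL FACT: the search refutes every 4-colouring below `z121Q2`. -/
theorem z121Q2_run : search z121nb 494 200 [] 494 z121Q2 = true := by
  decide +kernel

/-- PIECE: no proper 4-colouring (for the neighbourhood words `z121nb`) is consistent with the state `z121Q2`. -/
theorem z121_piece2 {col : ℕ → ℕ} (hP : Proper z121nb 494 col) :
    UBound 494 z121Q2 → Cons 494 col z121Q2 → False :=
  search_sound hP (done := []) (by simp) 494 _ z121Q2_run

set_option maxHeartbeats 400000000 in
set_option maxRecDepth 200000 in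
/-- KERNEL FACT: the search refutes every 4-colouring below `z121Q3`. -/
theorem z121Q3_run : search z121nb 494 200 [] 494 z121Q3 = true := by
  decide +kernel

/-- PIECE: no proper 4-colouring (for the neighbourhood words `z121nb`) is consistent with the state `z121Q3`. -/
theorem z121_piece3 {col : ℕ → ℕ} (hP : Proper z121nb 494 col) :
    UBound 494 z121Q3 → Cons 494 col z121Q3 → False :=
  search_sound hP (done := []) (by simp) 494 _ z121Q3_run

end Summit.Ventures.DiscreteObjects.UnitDistance
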